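import Summits.CriticalPhenomena.PercolationContinuityZ3.Theorems.PercNearOneGluingNoHeavyQuantGatedSliceMixLawKinkU1
import HarnessLib

/-!
# QUANT lane R8, T-DEC, leg (III), blob case — the thin regime of `MixLawCellPDear`: the twin-gap usage bound WITH ITS SLACK,
# `B₁ ≥ LB1` for a light shifted low (arm-2 g36's `usage_twin_gap_lb`, the light branch of `usage_twin_gap` kept exact)

builds on p205010 (kernel theorem, internal audit signed; external expert review pending)

Support file (`--supports stmt-CriticalPhenomena-4575`), QUANT lane lead seat prim-quant-lead (gen 33), rung R8 of
`run/shared/lean/prim/quant/LADDER.md`.  Memo: arm-2 g36 `…/prim-quant-arm-2-g36/THIN-REGIME-G36.md` §2/§5 (NOTE there: "`usage_twin_gap` proves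
B₁ ≥ 0 only; the bound B₁ ≥ LB1 (light ℓ) is the SAME computation … a successor should re-prove it").  One theorem, standard axioms, no sorries;
the computation is arm-2's (`…QuantGatedSliceMixLawKinkU1`, light branch) with the slack `P = (k₁+k₂−t)[k₁(k₂−k₁)² + a(k₂−a)(k₁+k₂−t)]`
kept instead of dropped: `B₁·Dn = (t−ℓ)(k₂−ℓ) − N(k₂−a) ≥ P/(k₂−k₁)²` and `Dn = (k₂−ℓ) − N ≤ k₂ − ℓ`, so `B₁ ≥ P/((k₂−k₁)²(k₂−ℓ)) = LB1`.

* **`LawDec.usage_twin_gap_lb`** — for `ℓ = k₁ + a` LIGHT at the mid `k₂` and `k₁` dear at `k₂`: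
  `usage(ℓ,k₂)·(k₂ − t + k₁)·(k₂−k₁)²(k₂−ℓ) ≤ (t − ℓ)(k₂−k₁)²(k₂−ℓ) − P` (i.e. `B₁ ≥ LB1`).
With `thin_C1_of_core` (`…ThinC1Glue`) this is the input of (♦) `k₁(m₂ − m₁) + B₁·m₁′ ≥ 0` ⟸ C1.  LEFT for the leaf: (♥)/(I_{U₁}) glue in the thin branch.

[this work]; computation: arm-2 g36.  Nothing here is cited as a published result.
-/

noncomputable section

namespace Summit.CriticalPhenomena.PercolationContinuityZ3.Theorems

namespace Quant

open Finset

namespace LawDec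

set_option maxHeartbeats 800000 in
/-- **`B₁ ≥ LB1` (light shifted low).**  Frame as `usage_twin_gap` plus `ℓ` light at `k₂` (`t − 2ℓ ≤ y(k₂ − ℓ)`). [this work] -/
theorem usage_twin_gap_lb (y t : ℝ) (j a k₁ k₂ : ℕ) (hy0 : 0 < y) (hy1 : y < 1) (hk₂j : k₂ ≤ j)
    (hk₁low : 2 * (k₁ : ℝ) < t) (hPlow : 2 * ((k₁ + a : ℕ) : ℝ) < t) (hk₂mid : t ≤ 2 * (k₂ : ℝ))
    (hcomp : t < ((k₁ + a : ℕ) : ℝ) + k₂) (hc1 : t < (k₁ : ℝ) + k₂)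
    (hdear : y * ((k₂ : ℝ) - k₁) ≤ t - 2 * (k₁ : ℝ))
    (hρ' : t - 2 * ((k₁ + a : ℕ) : ℝ) ≤ y * ((k₂ : ℝ) - ((k₁ + a : ℕ) : ℝ))) :
    usage y t j (k₁ + a) k₂ * ((k₂ : ℝ) - t + k₁) * (((k₂ : ℝ) - k₁) ^ 2 * ((k₂ : ℝ) - ((k₁ : ℝ) + a)))
      ≤ (t - ((k₁ : ℝ) + a)) * (((k₂ : ℝ) - k₁) ^ 2 * ((k₂ : ℝ) - ((k₁ : ℝ) + a)))
        - ((k₁ : ℝ) + k₂ - t) * ((k₁ : ℝ) * ((k₂ : ℝ) - k₁) ^ 2 + (a : ℝ) * ((k₂ : ℝ) - a) * ((k₁ : ℝ) + k₂ - t)) := by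
  have hdcast : ((k₁ + a : ℕ) : ℝ) = (k₁ : ℝ) + a := by push_cast; ring
  have ha0 : (0 : ℝ) ≤ a := Nat.cast_nonneg a
  have hk₁0 : (0 : ℝ) ≤ k₁ := Nat.cast_nonneg k₁
  have h1y : 0 < 1 - y := by linarith
  have hd : (0 : ℝ) < (k₂ : ℝ) - ((k₁ : ℝ) + a) := by rw [hdcast] at hPlow; linarith
  have hden : (0 : ℝ) < (k₂ : ℝ) - t + k₁ := by linarith
  rw [usage_eq_light' y t j (k₁ + a) k₂ hy0 hy1 hk₂j hPlow hcomp hρ', hdcast]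
  rw [hdcast] at hρ' hcomp hPlow
  have hDn : 0 < (1 - y) * ((1 - y) * ((k₁ : ℝ) + a) + (1 + y) * k₂ - t) := by
    apply mul_pos h1y; nlinarith
  set N : ℝ := y ^ 2 * ((k₂ : ℝ) - ((k₁ : ℝ) + a)) + (1 - y) * (t - 2 * ((k₁ : ℝ) + a)) with hN
  have eDn : (1 - y) * ((1 - y) * ((k₁ : ℝ) + a) + (1 + y) * k₂ - t) = ((k₂ : ℝ) - ((k₁ : ℝ) + a)) - N := by
    rw [hN]; ring
  have hN0 : 0 ≤ N := by rw [hN]; nlinarith [sq_nonneg y]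
  -- monotonicity in y ≤ ρ₁: with Y := y(k₂−k₁) ≤ t − 2k₁,  N(k₂−k₁)² ≤ f(t−2k₁)
  have hK : (0 : ℝ) < (k₂ : ℝ) - k₁ := by linarith
  set Y : ℝ := y * ((k₂ : ℝ) - k₁) with hY
  have hYle : Y ≤ t - 2 * (k₁ : ℝ) := hdear
  have hYlight : (t - 2 * ((k₁ : ℝ) + a)) * ((k₂ : ℝ) - k₁) ≤ Y * ((k₂ : ℝ) - ((k₁ : ℝ) + a)) := by
    rw [hY]; nlinarith
  have eNK : N * ((k₂ : ℝ) - k₁) ^ 2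
      = Y ^ 2 * ((k₂ : ℝ) - ((k₁ : ℝ) + a)) + ((k₂ : ℝ) - k₁) * (((k₂ : ℝ) - k₁) - Y) * (t - 2 * ((k₁ : ℝ) + a)) := by
    rw [hN, hY]; ring
  -- f(R) − f(Y) = (R − Y)[(R + Y)(k₂−ℓ) − (k₂−k₁)(t−2ℓ)] ≥ 0 for R = t − 2k₁
  have hmono : Y ^ 2 * ((k₂ : ℝ) - ((k₁ : ℝ) + a)) + ((k₂ : ℝ) - k₁) * (((k₂ : ℝ) - k₁) - Y) * (t - 2 * ((k₁ : ℝ) + a))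
      ≤ (t - 2 * (k₁ : ℝ)) ^ 2 * ((k₂ : ℝ) - ((k₁ : ℝ) + a))
        + ((k₂ : ℝ) - k₁) * (((k₂ : ℝ) - k₁) - (t - 2 * (k₁ : ℝ))) * (t - 2 * ((k₁ : ℝ) + a)) := by
    have e : (t - 2 * (k₁ : ℝ)) ^ 2 * ((k₂ : ℝ) - ((k₁ : ℝ) + a))
        + ((k₂ : ℝ) - k₁) * (((k₂ : ℝ) - k₁) - (t - 2 * (k₁ : ℝ))) * (t - 2 * ((k₁ : ℝ) + a))
        - (Y ^ 2 * ((k₂ : ℝ) - ((k₁ : ℝ) + a)) + ((k₂ : ℝ) - k₁) * (((k₂ : ℝ) - k₁) - Y) * (t - 2 * ((k₁ : ℝ) + a)))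
        = ((t - 2 * (k₁ : ℝ)) - Y) * (((t - 2 * (k₁ : ℝ)) * ((k₂ : ℝ) - ((k₁ : ℝ) + a)))
            + (Y * ((k₂ : ℝ) - ((k₁ : ℝ) + a)) - ((k₂ : ℝ) - k₁) * (t - 2 * ((k₁ : ℝ) + a)))) := by ring
    have h1 : 0 ≤ (t - 2 * (k₁ : ℝ)) * ((k₂ : ℝ) - ((k₁ : ℝ) + a)) := mul_nonneg (by linarith) hd.le
    have h2 : 0 ≤ Y * ((k₂ : ℝ) - ((k₁ : ℝ) + a)) - ((k₂ : ℝ) - k₁) * (t - 2 * ((k₁ : ℝ) + a)) := by linarith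
    nlinarith [mul_nonneg (sub_nonneg.2 hYle) (add_nonneg h1 h2), e]
  -- at Y = t − 2k₁:  (t−ℓ)(k₂−ℓ)(k₂−k₁)² − f(t−2k₁)(k₂−a) = (k₁+k₂−t)[k₁(k₂−k₁)² + a(k₂−a)(k₁+k₂−t)] ≥ 0
  have eP : (t - ((k₁ : ℝ) + a)) * ((k₂ : ℝ) - ((k₁ : ℝ) + a)) * ((k₂ : ℝ) - k₁) ^ 2
      - ((t - 2 * (k₁ : ℝ)) ^ 2 * ((k₂ : ℝ) - ((k₁ : ℝ) + a))
        + ((k₂ : ℝ) - k₁) * (((k₂ : ℝ) - k₁) - (t - 2 * (k₁ : ℝ))) * (t - 2 * ((k₁ : ℝ) + a))) * ((k₂ : ℝ) - a)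
      = ((k₁ : ℝ) + k₂ - t) * ((k₁ : ℝ) * ((k₂ : ℝ) - k₁) ^ 2 + (a : ℝ) * ((k₂ : ℝ) - a) * ((k₁ : ℝ) + k₂ - t)) := by ring
  have hka : (0 : ℝ) ≤ (k₂ : ℝ) - a := by linarith
  have hP : 0 ≤ ((k₁ : ℝ) + k₂ - t) * ((k₁ : ℝ) * ((k₂ : ℝ) - k₁) ^ 2 + (a : ℝ) * ((k₂ : ℝ) - a) * ((k₁ : ℝ) + k₂ - t)) :=
    mul_nonneg (by linarith) (add_nonneg (mul_nonneg hk₁0 (sq_nonneg _)) (mul_nonneg (mul_nonneg ha0 hka) (by linarith)))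
  -- the exact slack: N(k₂−a)(k₂−k₁)² ≤ (t−ℓ)(k₂−ℓ)(k₂−k₁)² − P
  have hN2 : N * ((k₂ : ℝ) - a) * ((k₂ : ℝ) - k₁) ^ 2
      ≤ (t - ((k₁ : ℝ) + a)) * ((k₂ : ℝ) - ((k₁ : ℝ) + a)) * ((k₂ : ℝ) - k₁) ^ 2
        - ((k₁ : ℝ) + k₂ - t) * ((k₁ : ℝ) * ((k₂ : ℝ) - k₁) ^ 2 + (a : ℝ) * ((k₂ : ℝ) - a) * ((k₁ : ℝ) + k₂ - t)) := by
    have h1 := mul_le_mul_of_nonneg_right hmono hka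
    have e2 : N * ((k₂ : ℝ) - a) * ((k₂ : ℝ) - k₁) ^ 2 = N * ((k₂ : ℝ) - k₁) ^ 2 * ((k₂ : ℝ) - a) := by ring
    rw [e2, eNK]
    linarith [h1, eP, hP]
  -- goal: (N/Dn)·(k₂−t+k₁)·K²(k₂−ℓ) ≤ (t−ℓ)K²(k₂−ℓ) − P ; multiply by Dn = (k₂−ℓ) − N > 0
  rw [eDn]
  have hDn' : 0 < ((k₂ : ℝ) - ((k₁ : ℝ) + a)) - N := by rw [← eDn]; exact hDn
  rw [div_mul_eq_mul_div, div_mul_eq_mul_div, div_le_iff₀ hDn']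
  set P : ℝ := ((k₁ : ℝ) + k₂ - t) * ((k₁ : ℝ) * ((k₂ : ℝ) - k₁) ^ 2 + (a : ℝ) * ((k₂ : ℝ) - a) * ((k₁ : ℝ) + k₂ - t)) with hPdef
  have e4 : N * ((k₂ : ℝ) - t + k₁) * (((k₂ : ℝ) - k₁) ^ 2 * ((k₂ : ℝ) - ((k₁ : ℝ) + a)))
      - ((t - ((k₁ : ℝ) + a)) * (((k₂ : ℝ) - k₁) ^ 2 * ((k₂ : ℝ) - ((k₁ : ℝ) + a))) - P) * (((k₂ : ℝ) - ((k₁ : ℝ) + a)) - N)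
      = ((k₂ : ℝ) - ((k₁ : ℝ) + a)) * (N * ((k₂ : ℝ) - a) * ((k₂ : ℝ) - k₁) ^ 2
          - (t - ((k₁ : ℝ) + a)) * ((k₂ : ℝ) - ((k₁ : ℝ) + a)) * ((k₂ : ℝ) - k₁) ^ 2 + P) - P * N := by
    rw [hPdef]; ring
  have h5 : ((k₂ : ℝ) - ((k₁ : ℝ) + a)) * (N * ((k₂ : ℝ) - a) * ((k₂ : ℝ) - k₁) ^ 2
      - (t - ((k₁ : ℝ) + a)) * ((k₂ : ℝ) - ((k₁ : ℝ) + a)) * ((k₂ : ℝ) - k₁) ^ 2 + P) ≤ 0 :=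
    mul_nonpos_of_nonneg_of_nonpos hd.le (by rw [hPdef]; linarith [hN2])
  have h6 : 0 ≤ P * N := mul_nonneg (by rw [hPdef]; exact hP) hN0
  linarith [e4, h5, h6]

end LawDec

end Quant

end Summit.CriticalPhenomena.PercolationContinuityZ3.Theorems
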